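import Summits.CriticalPhenomena.SAWScalingLimit.Theorems.ConfinementPositivity.Negative.Cusp1Domains
import Summits.CriticalPhenomena.SAWScalingLimit.Theorems.ConfinementPositivity.Negative.Cusp5Injection
import Summits.CriticalPhenomena.SAWScalingLimit.Theorems.SAWRenewalTightnessShellCrossingBoundConfinementRatio

/-!
# `ConfinementPositivity` (stmt-CriticalPhenomena-17587) — negative knowledge, cusp series part 6 (conclusion): the sockets are load-bearing

Refuter crux-attack support file (cdisprove) for the crux
`Summit.CriticalPhenomena.SAWScalingLimit.Theses.SAWRenewalTightness.ConfinementPositivity`.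

* `false_without_sockets` — deleting the socket hypothesis
  `D.carrier ∩ (ball (D.pt 0) d ∪ ball (D.pt 1) d) ⊆ D'.carrier` from the crux (all other
  hypotheses verbatim: `0 < d`, nesting, same marked points, an honest endpoint approximation
  of `D'`) makes it FALSE.  Witness (`exists_cuspPair`): the cusp `D' = {0<x<1, |y|<x²/16}`
  inside `D = {0<x<1, -1<y<x²/16}`, marked at `a = 0`, `b = 1`, with `a_δ = (1,0)`,
  `b_δ = (⌈δ⁻¹⌉-1, 0)`.  At `δ = 1/k²` the cusp's discrete domain starts with a bare corridor of
  `4k` sites, so `c · Z_D ≤ Z_{D'}` (the crux at `δ`, ratio form) and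
  `(4k-1) x_c⁴ Z_{D'} ≤ Z_D` (`fat_weight_ge`: detours) give `c (4k-1) x_c⁴ ≤ 1` for all large
  `k` — absurd.
* `false_without_radiusPos` — consequently `0 < d` is load-bearing too (take `d = 0`).

Moral for provers: the constant `c` must degenerate with the socket radius; any proof of the
crux has to use the agreement of `∂D` and `∂D'` near the marked points quantitatively.
Written on the VERBATIM body of the crux with one hypothesis deleted; no positive Theses
conclusion. Everything proved, standard axioms. [folklore]
-/

noncomputable section

namespace Summit.CriticalPhenomena.SAWScalingLimit.Theorems.ConfinementPositivity.Negative

open Set Metric Filter Topology Complex MeasureTheory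
open scoped ENNReal
open Literature.Probability.RandomPlanarGeometry Literature.Probability.LatticeModels
open Summit.CriticalPhenomena.SAWScalingLimit.Theorems

/-- The easy direction of the ratio audit, pointwise in `δ` and hypothesis-free: a lower bound
`c ≤ law_D(Conf)` forces `c · Z_D ≤ Z_{D'}`. [folklore] -/
theorem ratio_of_law_ge {Ω Ω' : Set ℂ} {δ c : ℝ} {u v : Site 2} (hc : 0 < c)
    (h : ENNReal.ofReal c ≤ SAW.law Ω δ u v
      {γ | ∃ γ' : SAW.DomainSAW Ω' δ u v, γ'.walk.support = γ.walk.support}) :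
    ENNReal.ofReal c * SAW.weight Ω δ u v Set.univ ≤ SAW.weight Ω' δ u v Set.univ := by
  rw [SAW.law_apply_eq_inv_mul_weight] at h
  set Z := SAW.weight Ω δ u v Set.univ
  set Z' := SAW.weight Ω' δ u v Set.univ
  have h' : ENNReal.ofReal c ≤ Z⁻¹ * Z' :=
    h.trans (mul_le_mul' le_rfl (SAW.weight_setOf_exists_support_eq_le _ _ δ u v))
  have hc' : (0 : ℝ≥0∞) < ENNReal.ofReal c := ENNReal.ofReal_pos.2 hc
  have hZtop : Z ≠ ⊤ := by
    intro htop
    rw [htop, ENNReal.inv_top, zero_mul] at h'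
    exact hc'.ne' (le_antisymm h' bot_le)
  by_cases hZ0 : Z = 0
  · rw [hZ0, mul_zero]; exact bot_le
  calc ENNReal.ofReal c * Z ≤ Z⁻¹ * Z' * Z := mul_le_mul' h' le_rfl
    _ = Z' := by rw [mul_comm, ← mul_assoc, ENNReal.mul_inv_cancel hZ0 hZtop, one_mul]

/-- Choice of the scale: a natural number `k ≥ 5` with `1/k² ≤ δ₀` and `(4k-1) · t > 1` for a
given `t > 0`. [folklore] -/
theorem exists_scale {δ₀ t : ℝ} (hδ₀ : 0 < δ₀) (ht : 0 < t) :
    ∃ k : ℕ, 5 ≤ k ∧ ((k : ℝ) ^ 2)⁻¹ ≤ δ₀ ∧ 1 < ((4 * k - 1 : ℕ) : ℝ) * t := by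
  obtain ⟨k, hk⟩ := exists_nat_gt (max 5 (max δ₀⁻¹ t⁻¹))
  have h5 : (5 : ℝ) < k := (le_max_left _ _).trans_lt hk
  have hδ : δ₀⁻¹ < k := ((le_max_left _ _).trans (le_max_right _ _)).trans_lt hk
  have htk : t⁻¹ < k := ((le_max_right _ _).trans (le_max_right _ _)).trans_lt hk
  have hk5 : 5 ≤ k := by exact_mod_cast h5.le
  refine ⟨k, hk5, ?_, ?_⟩
  · have hkpos : (0 : ℝ) < k := by linarith
    have h1 : ((k : ℝ) ^ 2)⁻¹ ≤ (k : ℝ)⁻¹ := by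
      apply inv_anti₀ hkpos; nlinarith
    have h2 : (k : ℝ)⁻¹ < δ₀ := by
      rw [inv_lt_comm₀ hkpos hδ₀]; exact hδ
    exact h1.trans h2.le
  · have hN : (k : ℝ) ≤ ((4 * k - 1 : ℕ) : ℝ) := by
      have : k ≤ 4 * k - 1 := by omega
      exact_mod_cast this
    have hkt : 1 < (k : ℝ) * t := by
      have := mul_lt_mul_of_pos_right htk ht
      rwa [inv_mul_cancel₀ ht.ne'] at this
    nlinarith

/-- **The sockets are load-bearing.** The crux WITHOUT the socket hypothesis
`D.carrier ∩ (Metric.ball (D.pt 0) d ∪ Metric.ball (D.pt 1) d) ⊆ D'.carrier` is FALSE (cusp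
witness, see the module docstring). [folklore] -/
theorem false_without_sockets :
    ¬ ∀ (D D' : DobrushinDomain) (a b : ℝ → Site 2) (d : ℝ), 0 < d → D'.carrier ⊆ D.carrier →
      D'.pt 0 = D.pt 0 → D'.pt 1 = D.pt 1 →
      SAW.IsEndpointApprox D' a b →
      ∃ c δ₀ : ℝ, 0 < c ∧ 0 < δ₀ ∧ ∀ δ ∈ Set.Ioc (0 : ℝ) δ₀,
        ENNReal.ofReal c ≤ SAW.law D.carrier δ (a δ) (b δ)
          {γ | ∃ γ' : SAW.DomainSAW D'.carrier δ (a δ) (b δ), γ'.walk.support = γ.walk.support} := by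
  intro h
  obtain ⟨D, D', hD', hD, hsub, h0, h1, h0', h1'⟩ := exists_cuspPair
  have hab : SAW.IsEndpointApprox D' (fun _ => ![1, 0]) (fun δ => ![⌈δ⁻¹⌉ - 1, 0]) :=
    strip_isEndpointApprox (lo := fun x : ℝ => -(x ^ 2 / 16)) (hi := fun x : ℝ => x ^ 2 / 16)
      hD' cusp_sign monotoneOn_sq_div antitoneOn_neg_sq_div h0' h1'
  obtain ⟨c, δ₀, hc, hδ₀, hall⟩ :=
    h D D' (fun _ => ![1, 0]) (fun δ => ![⌈δ⁻¹⌉ - 1, 0]) 1 one_pos hsub h0 h1 hab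
  have hxc : 0 < SAW.criticalFugacity := SAW.criticalFugacity_pos
  obtain ⟨k, hk5, hkδ, hkt⟩ := exists_scale hδ₀ (mul_pos hc (pow_pos hxc 4))
  -- the scale `δ = 1/k²` and the far endpoint `B = ⌈δ⁻¹⌉ - 1 = k² - 1`
  set δ : ℝ := ((k : ℝ) ^ 2)⁻¹ with hδdef
  have hk1 : 1 ≤ k := by omega
  have hkR : (5 : ℝ) ≤ k := by exact_mod_cast hk5
  have hδpos : 0 < δ := by positivity
  have hδ1 : δ < 1 := by
    rw [hδdef]; apply inv_lt_one_of_one_lt₀; nlinarith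
  have hceil : ⌈δ⁻¹⌉ = (k : ℤ) ^ 2 := by
    rw [hδdef, inv_inv]
    have : ((k : ℝ) ^ 2) = (((k : ℤ) ^ 2 : ℤ) : ℝ) := by norm_cast
    rw [this, Int.ceil_intCast]
  set B : ℤ := ⌈δ⁻¹⌉ - 1 with hBdef
  have hB : 4 * (k : ℤ) + 1 ≤ B := by
    rw [hBdef, hceil]
    have : (5 : ℤ) ≤ k := by exact_mod_cast hk5
    nlinarith
  have hmain := hall δ ⟨hδpos, hkδ⟩
  beta_reduce at hmain
  -- the crux at `δ`: `c · Z_D ≤ Z_{D'}`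
  have hratio := ratio_of_law_ge hc hmain
  -- the detours: `(4k-1) x_c⁴ Z_{D'} ≤ Z_D`
  have hdet := fat_weight_ge hD' hD hk5 hB
  change ((4 * k - 1 : ℕ) : ℝ≥0∞) * ENNReal.ofReal (SAW.criticalFugacity ^ 4) *
      SAW.weight D'.carrier δ ![1, 0] ![B, 0] Set.univ ≤
    SAW.weight D.carrier δ ![1, 0] ![B, 0] Set.univ at hdet
  set Z := SAW.weight D.carrier δ ![1, 0] ![B, 0] Set.univ with hZdef
  set Z' := SAW.weight D'.carrier δ ![1, 0] ![B, 0] Set.univ with hZ'def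
  -- `0 < Z' < ∞`
  have hbB := stdA_bounds hδpos hδ1
  have hreach : (discreteDomainGraph D'.carrier δ).Reachable ![1, 0] ![B, 0] :=
    strip_dd_reachable (lo := fun x : ℝ => -(x ^ 2 / 16)) (hi := fun x : ℝ => x ^ 2 / 16) hD'
      cusp_sign monotoneOn_sq_div antitoneOn_neg_sq_div hδpos hδ1
      (strip_one_mem (lo := fun x : ℝ => -(x ^ 2 / 16)) (hi := fun x : ℝ => x ^ 2 / 16) hD'
        cusp_sign hδpos hδ1)
      (strip_axis_mem (lo := fun x : ℝ => -(x ^ 2 / 16)) (hi := fun x : ℝ => x ^ 2 / 16) hD'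
        cusp_sign hbB.1 hbB.2)
  have hZ'0 : Z' ≠ 0 := ConfinementAudit.weight_univ_ne_zero hreach
  have hZ'top : Z' ≠ ⊤ := ConfinementAudit.weight_univ_ne_top D'.isBounded hδpos
  -- combine
  have hchain : ENNReal.ofReal c * ((4 * k - 1 : ℕ) : ℝ≥0∞) *
      ENNReal.ofReal (SAW.criticalFugacity ^ 4) * Z' ≤ 1 * Z' := by
    rw [one_mul]
    calc ENNReal.ofReal c * ((4 * k - 1 : ℕ) : ℝ≥0∞) * ENNReal.ofReal (SAW.criticalFugacity ^ 4) * Z'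
        = ENNReal.ofReal c * (((4 * k - 1 : ℕ) : ℝ≥0∞) *
            ENNReal.ofReal (SAW.criticalFugacity ^ 4) * Z') := by ring
      _ ≤ ENNReal.ofReal c * Z := mul_le_mul' le_rfl hdet
      _ ≤ Z' := hratio
  have h2 : ENNReal.ofReal c * ((4 * k - 1 : ℕ) : ℝ≥0∞) *
      ENNReal.ofReal (SAW.criticalFugacity ^ 4) ≤ 1 :=
    (ENNReal.mul_le_mul_iff_left hZ'0 hZ'top).1 hchain
  have h3 : ENNReal.ofReal (c * ((4 * k - 1 : ℕ) : ℝ) * SAW.criticalFugacity ^ 4) ≤ 1 := by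
    rwa [ENNReal.ofReal_mul (by positivity), ENNReal.ofReal_mul hc.le, ENNReal.ofReal_natCast]
  have h4 : c * ((4 * k - 1 : ℕ) : ℝ) * SAW.criticalFugacity ^ 4 ≤ 1 := ENNReal.ofReal_le_one.1 h3
  have : c * ((4 * k - 1 : ℕ) : ℝ) * SAW.criticalFugacity ^ 4 =
      ((4 * k - 1 : ℕ) : ℝ) * (c * SAW.criticalFugacity ^ 4) := by ring
  rw [this] at h4
  linarith

/-- **`0 < d` is load-bearing** (the crux WITHOUT `0 < d` is FALSE): with `d = 0` the socket
condition is empty, and the cusp witness applies. [folklore] -/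
theorem false_without_radiusPos :
    ¬ ∀ (D D' : DobrushinDomain) (a b : ℝ → Site 2) (d : ℝ), D'.carrier ⊆ D.carrier →
      D'.pt 0 = D.pt 0 → D'.pt 1 = D.pt 1 →
      D.carrier ∩ (Metric.ball (D.pt 0) d ∪ Metric.ball (D.pt 1) d) ⊆ D'.carrier →
      SAW.IsEndpointApprox D' a b →
      ∃ c δ₀ : ℝ, 0 < c ∧ 0 < δ₀ ∧ ∀ δ ∈ Set.Ioc (0 : ℝ) δ₀,
        ENNReal.ofReal c ≤ SAW.law D.carrier δ (a δ) (b δ)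
          {γ | ∃ γ' : SAW.DomainSAW D'.carrier δ (a δ) (b δ), γ'.walk.support = γ.walk.support} := by
  intro h
  refine false_without_sockets fun D D' a b d _ hsub h0 h1 hab => ?_
  exact h D D' a b 0 hsub h0 h1 (by simp) hab

end Summit.CriticalPhenomena.SAWScalingLimit.Theorems.ConfinementPositivity.Negative

end
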